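/-
Copyright (c) 2026. All rights reserved.
Released under Apache 2.0 license as described in the file LICENSE.
Authors: abc-iut cell, prover seat abc-iut-E-t42 (gen 7).
-/
import Literature.NumberTheory.NumberFields.QuarticCertificateChecker
import Literature.NumberTheory.NumberFields.QuarticConjugateBounds
import HarnessLib

/-!
# Quartic number fields with `d_K ∈ {±48, ±144}` and a prime of norm `2` have a quadratic irrationality `t² = d`

A KERNEL-CHECKED Hunter–Pohst enumeration (classical method: Pohst 1982, Buchmann–Ford; here from Mathlib's convex
body theorem, no table is assumed).  Let `K` be a quartic number field with `d_K ∈ {48, −48, 144, −144}` possessing an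
integral ideal `J` of norm `2`.  Minkowski's ℓ¹ body on the lattice `J` (`MinkowskiConjugateSumBound`) gives
`a ∈ J ∖ 0` with `(∑_σ |σa|)⁴ ≤ 2·(4/π)^{r₂}·4!·√|d_K| ≤ 934` (`540` when `|d_K| = 48`); by AM–GM `N(a) = ±2`, and the
integer characteristic data `s = (s₁, s₂, s₃, ±2)` of `a` (`QuarticConjugateSums`) lies in the box `|s₁| ≤ 5`,
`|s₂| ≤ 11`, `|s₃| ≤ 10` (`4, 8, 7` at `|d_K| = 48`; `QuarticConjugateBounds`).  The two `decide`d theorems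
`check144`, `check48` certify EVERY tuple of these boxes (`QuarticCertificateChecker.certOK`): either the Hankel
discriminant is not `m²·d_K`, or the quartic has a root in `{±1, ±2}` (then `N(a) = r⁴ ≠ ±2`), or a power sum
`Tr(a^k)` exceeds what the conjugate moduli allow, or an explicit `g ∈ ℤ[X]` has `g(a)² = d` with `d` a non-square,
or (two tuples) the quartic is positive on `ℝ` and the pairing bound kills it.  Hence:

* **`exists_sq_eq_nonsquare_of_absNorm_eq_two`** — such a `K` contains `t` with `t² = d`, `d ∈ ℤ` not a square
  (so `K` has a quadratic subfield).

Nothing here is specific to the abc-iut consumer (R-J row Y-26 / R-32: pinned quartic fields have `|d_F| ∈ {48, 144}`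
and a dyadic prime of residue degree `1`). [cite: EsmondeMurty1999, Ex. 6.5.12 and Ex. 6.5.21 p. 93]
[cite: NeukirchANT1999, Ch. I §2, (2.2)–(2.9)]
-/

namespace Literature.NumberTheory.NumberFields

open NumberField NumberField.InfinitePlace Module Finset QuarticCert

namespace QuarticCert

/-! ## Certificate tables and the two kernel checks -/

/-- Square-root witnesses `(s, (g, d, q))` for `d_K = 144`: `g² − d = q·χ_s`. [cite: EsmondeMurty1999, Ex. 6.5.12 and Ex. 6.5.21 p. 93] -/
def sq144 : List ((ℤ × ℤ × ℤ × ℤ) × (List ℤ × ℤ × List ℤ)) :=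
  [((-4, 2, 4, -2), ([-8, -4, 6, 2], 24, [-20, 8, 4])),
   ((-2, 7, -6, 2), ([-13, -28, -6, -4], -63, [116, 16, 16])),
   ((0, 2, -4, 2), ([-10, -12, 2, -4], -36, [68, -16, 16])),
   ((0, 2, 4, 2), ([-10, 12, 2, 4], -36, [68, 16, 16])),
   ((2, 7, 6, 2), ([-13, 28, -6, 4], -63, [116, -16, 16])),
   ((4, 2, -4, -2), ([2, 4, -2], 12, [4]))]

/-- Positivity-and-pairing certificates `(s, (u, v, k))` for `d_K = 144` (the pair `X⁴ ∓ 2X³ + 6X² ∓ 4X + 2`).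
[cite: EsmondeMurty1999, Ex. 6.5.12 and Ex. 6.5.21 p. 93] -/
def ps144 : List ((ℤ × ℤ × ℤ × ℤ) × (ℤ × ℤ × ℕ)) := [((-2, 6, -4, 2), (1, 0, 5)), ((2, 6, 4, 2), (-1, 0, 5))]

/-- Square-root witnesses for `d_K = −144`. [cite: EsmondeMurty1999, Ex. 6.5.12 and Ex. 6.5.21 p. 93] -/
def sqm144 : List ((ℤ × ℤ × ℤ × ℤ) × (List ℤ × ℤ × List ℤ)) :=
  [((-1, -1, 7, -2), ([-5, -3, 0, 1], 17, [-4, -1, 1])),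
   ((1, -1, -7, -2), ([-5, 3, 0, -1], 17, [-4, 1, 1]))]

/-- Square-root witnesses for `d_K = −48`. [cite: EsmondeMurty1999, Ex. 6.5.12 and Ex. 6.5.21 p. 93] -/
def sqm48 : List ((ℤ × ℤ × ℤ × ℤ) × (List ℤ × ℤ × List ℤ)) :=
  [((-2, 0, 4, -2), ([-6, -4, 2, 2], 12, [-12, 0, 4])),
   ((2, 0, -4, -2), ([-6, 4, 2, -2], 12, [-12, 0, 4]))]

set_option maxRecDepth 4000 in
/-- **Kernel check at `|d_K| = 144`**: every `s` with `|s₁| ≤ 5`, `|s₂| ≤ 11`, `|s₃| ≤ 10`, `s₄ = ±2` is certified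
against `d_K = 144` and `d_K = −144` (modulus constant `2.89`). [cite: EsmondeMurty1999, Ex. 6.5.12 and Ex. 6.5.21 p. 93] -/
theorem check144 :
    ((box 5 11 10).all fun s => certOK 144 289 sq144 ps144 s && certOK (-144) 289 sqm144 [] s) = true := by
  decide +kernel

set_option maxRecDepth 4000 in
/-- **Kernel check at `|d_K| = 48`**: every `s` with `|s₁| ≤ 4`, `|s₂| ≤ 8`, `|s₃| ≤ 7`, `s₄ = ±2` is certified against
`d_K = 48` and `d_K = −48` (modulus constant `1.66`). [cite: EsmondeMurty1999, Ex. 6.5.12 and Ex. 6.5.21 p. 93] -/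
theorem check48 :
    ((box 4 8 7).all fun s => certOK 48 166 [] [] s && certOK (-48) 166 sqm48 [] s) = true := by
  decide +kernel

end QuarticCert

/-! ## Number-field soundness -/

section Soundness

variable {K : Type*} [Field K] [NumberField K]

/-- A real number with `x⁴ ≤ B⁴`-type bound: `x ^ 4 ≤ M`, `M ≤ B ^ 4`, `0 ≤ B` give `x ≤ B`.
[cite: EsmondeMurty1999, Ex. 6.5.12 and Ex. 6.5.21 p. 93] -/
theorem le_of_pow_four_le {x M B : ℝ} (hB : 0 ≤ B) (h : x ^ 4 ≤ M) (hM : M ≤ B ^ 4) : x ≤ B :=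
  le_of_pow_le_pow_left₀ (by norm_num : (4 : ℕ) ≠ 0) hB (h.trans hM)

/-- An integer whose real absolute value is `< n + 1` has `|z| ≤ n`. [cite: EsmondeMurty1999, Ex. 6.5.12 and Ex. 6.5.21 p. 93] -/
theorem int_abs_le_of_lt {z : ℤ} {n : ℕ} (h : (|z| : ℝ) < n + 1) : |z| ≤ n := by
  have : |z| < (n : ℤ) + 1 := by exact_mod_cast h
  omega

/-- Real-arithmetic core of the power-sum kill: `4c^k < 100^k|p|` is incompatible with `|p| ≤ 4(c/100)^k`.
[cite: EsmondeMurty1999, Ex. 6.5.12 and Ex. 6.5.21 p. 93] -/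
theorem powKill_false {c k : ℕ} {p : ℤ} (hk : 4 * (c : ℤ) ^ k < 100 ^ k * |p|)
    (hle : (|p| : ℝ) ≤ 4 * ((c : ℝ) / 100) ^ k) : False := by
  have hkR : (4 : ℝ) * (c : ℝ) ^ k < 100 ^ k * (|p| : ℝ) := by exact_mod_cast hk
  have : (100 : ℝ) ^ k * (|p| : ℝ) ≤ 100 ^ k * (4 * ((c : ℝ) / 100) ^ k) :=
    mul_le_mul_of_nonneg_left hle (by positivity)
  rw [div_pow, show (100 : ℝ) ^ k * (4 * ((c : ℝ) ^ k / 100 ^ k)) = 4 * (c : ℝ) ^ k by field_simp] at this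
  linarith

/-- Real-arithmetic core of the pairing kill: `2(210^k + 120^k) < 100^k|p|` is incompatible with
`|p| ≤ 2(ρ₁^k + ρ₂^k)`, `ρ₁^k + ρ₂^k ≤ 2.1^k + 1.2^k`. [cite: EsmondeMurty1999, Ex. 6.5.12 and Ex. 6.5.21 p. 93] -/
theorem pairKill_false {k : ℕ} {p : ℤ} {ρ₁ ρ₂ : ℝ} (hk : 2 * ((210 : ℤ) ^ k + 120 ^ k) < 100 ^ k * |p|)
    (hle : (|p| : ℝ) ≤ 2 * (ρ₁ ^ k + ρ₂ ^ k)) (hpair : ρ₁ ^ k + ρ₂ ^ k ≤ (21 / 10 : ℝ) ^ k + (6 / 5 : ℝ) ^ k) : False := by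
  have hkR : (2 : ℝ) * ((210 : ℝ) ^ k + 120 ^ k) < 100 ^ k * (|p| : ℝ) := by exact_mod_cast hk
  have h100 : (100 : ℝ) ^ k * (|p| : ℝ) ≤ 100 ^ k * (2 * ((21 / 10 : ℝ) ^ k + (6 / 5 : ℝ) ^ k)) :=
    mul_le_mul_of_nonneg_left (hle.trans (by linarith)) (by positivity)
  have hid : (100 : ℝ) ^ k * (2 * ((21 / 10 : ℝ) ^ k + (6 / 5 : ℝ) ^ k)) = 2 * ((210 : ℝ) ^ k + 120 ^ k) := by
    have e1 : (210 : ℝ) ^ k = 100 ^ k * (21 / 10) ^ k := by rw [← mul_pow]; norm_num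
    have e2 : (120 : ℝ) ^ k = 100 ^ k * (6 / 5) ^ k := by rw [← mul_pow]; norm_num
    rw [e1, e2]; ring
  linarith

/-- **The box step**: integer characteristic data within the Minkowski bounds lies in the certified box, so `certOK`
fires, with the modulus constant matching the sum bound. [cite: EsmondeMurty1999, Ex. 6.5.12 and Ex. 6.5.21 p. 93] -/
theorem certOK_of_bounds {D : ℤ} (hD : D = 144 ∨ D = -144 ∨ D = 48 ∨ D = -48) {s₁ s₂ s₃ s₄ : ℤ} {S : ℝ}
    (hS0 : 0 ≤ S) (hb₁ : (|s₁| : ℝ) ≤ S) (hb₂ : 8 * (|s₂| : ℝ) ≤ 3 * S ^ 2) (hb₃ : 16 * (|s₃| : ℝ) ≤ S ^ 3)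
    (hs4 : s₄ = 2 ∨ s₄ = -2) (hS : S ^ 4 ≤ 934) (hS48 : D.natAbs = 48 → S ^ 4 ≤ 540) :
    ∃ (c : ℕ) (sq : List ((ℤ × ℤ × ℤ × ℤ) × (List ℤ × ℤ × List ℤ))) (ps : List ((ℤ × ℤ × ℤ × ℤ) × (ℤ × ℤ × ℕ))),
      certOK D c sq ps (s₁, s₂, s₃, s₄) = true ∧ ((c = 289 ∧ S ≤ 553 / 100) ∨ (c = 166 ∧ S ≤ 4821 / 1000)) := by
  rcases hD with rfl | rfl | rfl | rfl
  · have hSB : S ≤ 553 / 100 := le_of_pow_four_le (by norm_num) hS (by norm_num)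
    have hmem : (s₁, s₂, s₃, s₄) ∈ box 5 11 10 := mem_box (int_abs_le_of_lt (by push_cast; nlinarith))
      (int_abs_le_of_lt (by push_cast; nlinarith)) (int_abs_le_of_lt (by push_cast; nlinarith)) hs4
    have := (List.all_eq_true.mp QuarticCert.check144) _ hmem
    rw [Bool.and_eq_true] at this
    exact ⟨289, _, _, this.1, Or.inl ⟨rfl, hSB⟩⟩
  · have hSB : S ≤ 553 / 100 := le_of_pow_four_le (by norm_num) hS (by norm_num)
    have hmem : (s₁, s₂, s₃, s₄) ∈ box 5 11 10 := mem_box (int_abs_le_of_lt (by push_cast; nlinarith))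
      (int_abs_le_of_lt (by push_cast; nlinarith)) (int_abs_le_of_lt (by push_cast; nlinarith)) hs4
    have := (List.all_eq_true.mp QuarticCert.check144) _ hmem
    rw [Bool.and_eq_true] at this
    exact ⟨289, _, _, this.2, Or.inl ⟨rfl, hSB⟩⟩
  · have hS' := hS48 rfl
    have hSB : S ≤ 4821 / 1000 := le_of_pow_four_le (by norm_num) hS' (by norm_num)
    have hmem : (s₁, s₂, s₃, s₄) ∈ box 4 8 7 := mem_box (int_abs_le_of_lt (by push_cast; nlinarith))
      (int_abs_le_of_lt (by push_cast; nlinarith)) (int_abs_le_of_lt (by push_cast; nlinarith)) hs4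
    have := (List.all_eq_true.mp QuarticCert.check48) _ hmem
    rw [Bool.and_eq_true] at this
    exact ⟨166, _, _, this.1, Or.inr ⟨rfl, hSB⟩⟩
  · have hS' := hS48 rfl
    have hSB : S ≤ 4821 / 1000 := le_of_pow_four_le (by norm_num) hS' (by norm_num)
    have hmem : (s₁, s₂, s₃, s₄) ∈ box 4 8 7 := mem_box (int_abs_le_of_lt (by push_cast; nlinarith))
      (int_abs_le_of_lt (by push_cast; nlinarith)) (int_abs_le_of_lt (by push_cast; nlinarith)) hs4
    have := (List.all_eq_true.mp QuarticCert.check48) _ hmem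
    rw [Bool.and_eq_true] at this
    exact ⟨166, _, _, this.2, Or.inr ⟨rfl, hSB⟩⟩

/-- **The certified box excludes or resolves every candidate.**  `K` quartic with `d_K = D ∈ {±48, ±144}`, an
enumeration `e` of its embeddings, `a ∈ 𝓞 K` with `N(a) = ±2` whose conjugate sum `S = ∑ |σa|` has `S⁴ ≤ 934` and,
if `|D| = 48`, `S⁴ ≤ 540`: then some `t ∈ K` has `t² = d` with `d ∈ ℤ` a non-square.
[cite: EsmondeMurty1999, Ex. 6.5.12 and Ex. 6.5.21 p. 93] -/
theorem exists_sq_eq_nonsquare_of_small (h4 : finrank ℚ K = 4) (e : (K →+* ℂ) ≃ Fin 4) {D : ℤ}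
    (hD : D = 144 ∨ D = -144 ∨ D = 48 ∨ D = -48) (hdisc : NumberField.discr K = D) (a : 𝓞 K)
    (hN : Algebra.norm ℤ a = 2 ∨ Algebra.norm ℤ a = -2)
    (hS : (∑ σ : K →+* ℂ, ‖σ (a : K)‖) ^ 4 ≤ 934)
    (hS48 : D.natAbs = 48 → (∑ σ : K →+* ℂ, ‖σ (a : K)‖) ^ 4 ≤ 540) :
    ∃ (t : K) (d : ℤ), t ^ 2 = (d : K) ∧ ¬ IsSquare d := by
  -- conjugates and integer characteristic data
  obtain ⟨s₁, s₂, s₃, s₄, hs₁, hs₄, h₁, h₂, h₃, h₄⟩ := exists_int_charData e a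
  set z₀ := (e.symm 0) (a : K) with hz₀
  set z₁ := (e.symm 1) (a : K) with hz₁
  set z₂ := (e.symm 2) (a : K) with hz₂
  set z₃ := (e.symm 3) (a : K) with hz₃
  have hSsum : ∑ σ : K →+* ℂ, ‖σ (a : K)‖ = ‖z₀‖ + ‖z₁‖ + ‖z₂‖ + ‖z₃‖ := sum_norm_embeddings_eq_sum e (a : K)
  have hP : ‖z₀‖ * ‖z₁‖ * ‖z₂‖ * ‖z₃‖ = 2 := by
    rw [← abs_norm_int_cast_eq_prod_norm e a]
    rcases hN with h | h <;> simp [h]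
  have hs4 : s₄ = 2 ∨ s₄ = -2 := by rw [hs₄]; exact hN
  let s : ℤ × ℤ × ℤ × ℤ := (s₁, s₂, s₃, s₄)
  -- roots and power sums
  have hroot : ∀ i : Fin 4, evalL (chiL s) ((e.symm i) (a : K)) = 0 := fun i => by
    rw [evalL_chiL]; exact conj_isRoot h₁ h₂ h₃ h₄ i
  have hself : evalL (chiL s) (a : K) = 0 := by
    rw [evalL_chiL]; exact self_isRoot h₁ h₂ h₃ h₄
  have hpsumC : ∀ n : ℕ, ((psum s n : ℤ) : ℂ) = z₀ ^ n + z₁ ^ n + z₂ ^ n + z₃ ^ n := fun n =>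
    psum_eq_sum_pow (s := s) h₁ h₂ h₃ (hroot 0) (hroot 1) (hroot 2) (hroot 3) n
  have hpsum : ∀ n : ℕ, psum s n = Algebra.trace ℤ (𝓞 K) (a ^ n) := fun n => by
    have := hpsumC n
    rw [← trace_int_pow_cast_eq_sum e a n] at this
    exact_mod_cast this
  -- the box
  set S := ‖z₀‖ + ‖z₁‖ + ‖z₂‖ + ‖z₃‖ with hSdef
  rw [hSsum] at hS hS48
  have hS0 : 0 ≤ S := by positivity
  have hb₁ : (|s₁| : ℝ) ≤ S := by
    have := norm_esymm_one_le z₀ z₁ z₂ z₃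
    rw [← h₁, Complex.norm_intCast] at this; exact this
  have hb₂ : 8 * (|s₂| : ℝ) ≤ 3 * S ^ 2 := by
    have := norm_esymm_two_le z₀ z₁ z₂ z₃
    rw [← h₂, Complex.norm_intCast] at this; exact this
  have hb₃ : 16 * (|s₃| : ℝ) ≤ S ^ 3 := by
    have := norm_esymm_three_le z₀ z₁ z₂ z₃
    rw [← h₃, Complex.norm_intCast] at this; exact this
  -- which box / which check, and the matching modulus bound `c / 100`
  have hDne : D ≠ 0 := by rcases hD with rfl | rfl | rfl | rfl <;> norm_num
  obtain ⟨c, sq, ps, hcert, hc⟩ := certOK_of_bounds hD hS0 hb₁ hb₂ hb₃ hs4 hS hS48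
  have hmod : ‖z₀‖ ≤ (c : ℝ) / 100 ∧ ‖z₁‖ ≤ (c : ℝ) / 100 ∧ ‖z₂‖ ≤ (c : ℝ) / 100 ∧ ‖z₃‖ ≤ (c : ℝ) / 100 := by
    rcases hc with ⟨rfl, hSB⟩ | ⟨rfl, hSB⟩
    · have := modulus_le_of_sum_le_553 (norm_nonneg z₀) (norm_nonneg z₁) (norm_nonneg z₂) (norm_nonneg z₃) hSB hP
      norm_num at this ⊢; exact this
    · have := modulus_le_of_sum_le_4821 (norm_nonneg z₀) (norm_nonneg z₁) (norm_nonneg z₂) (norm_nonneg z₃) hSB hP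
      norm_num at this ⊢
      obtain ⟨a0, a1, a2, a3⟩ := this
      exact ⟨by linarith, by linarith, by linarith, by linarith⟩
  -- case analysis on the certificate
  rcases certOK_cases hcert with hA | hB | hDk | ⟨w, hw⟩ | ⟨w, hw⟩
  · -- [A] the Hankel discriminant is m² · d_K: contradiction
    exfalso
    obtain ⟨m, hm⟩ := hankel_traces_det_eq_sq_mul_discr h4 a
    have hH : hankelDet s = m ^ 2 * D := by
      rw [hankelDet_eq_det, ← hdisc, ← hm]
      congr 1
      ext i j
      simp [hpsum]
    exact ne_sq_mul_of_notSqClass hDne hA m hH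
  · -- [B] an integer root: N(a) = r⁴ ≠ ±2
    exfalso
    obtain ⟨r, hr, hr0⟩ := exists_root_of_hasIntRoot hB
    have hN4 : Algebra.norm ℤ a = r ^ 4 :=
      norm_eq_pow_four_of_int_isRoot h₁ h₂ h₃ h₄ (by simpa [chiAt] using hr0)
    rcases hr with rfl | rfl | rfl | rfl <;> rcases hN with h | h <;> omega
  · -- [D] a power sum is too large for the conjugate moduli
    exfalso
    obtain ⟨k, hk⟩ := exists_of_powKill hDk
    obtain ⟨m0, m1, m2, m3⟩ := hmod
    have hle := abs_trace_pow_le_of_conj_le e a m0 m1 m2 m3 k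
    rw [← hpsum k] at hle
    exact powKill_false hk hle
  · -- [E] an explicit square root of a non-square integer
    obtain ⟨hsq, hns⟩ := sq_eq_of_checkSqrt hw hself
    exact ⟨_, _, hsq, hns⟩
  · -- [P] the quartic is positive on ℝ: K totally complex, pairing bound
    exfalso
    obtain ⟨hpos, hk⟩ := pos_of_checkPos hw
    have hcx : ∀ w : InfinitePlace K, w.IsComplex :=
      isComplex_of_forall_pos e h₁ h₂ h₃ h₄ (by simpa using hpos)
    obtain ⟨w₁, w₂, -, hsumw, hprodw, htr⟩ := exists_pair_of_isComplex h4 hcx a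
    rw [hSsum] at hsumw
    have hprod2 : w₁ (a : K) ^ 2 * w₂ (a : K) ^ 2 = 2 := by
      rw [hprodw]; rcases hN with h | h <;> simp [h]
    have hsum4 : (2 * w₁ (a : K) + 2 * w₂ (a : K)) ^ 4 ≤ 934 := by rw [← hsumw]; exact hS
    have hpair := pair_pow_le (apply_nonneg _ _) (apply_nonneg _ _) hprod2 hsum4 w.2.2
    have hle := htr w.2.2
    rw [← hpsum] at hle
    exact pairKill_false hk hle hpair

/-- **Main theorem.**  A quartic number field with `d_K ∈ {48, −48, 144, −144}` and an integral ideal of norm `2`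
contains `t` with `t² = d` for some non-square integer `d` (hence a quadratic subfield).  Kernel-checked Hunter–Pohst
enumeration over Minkowski's ℓ¹ body; no table assumed. [cite: EsmondeMurty1999, Ex. 6.5.12 and Ex. 6.5.21 p. 93] -/
theorem exists_sq_eq_nonsquare_of_absNorm_eq_two (h4 : finrank ℚ K = 4) {D : ℤ}
    (hD : D = 144 ∨ D = -144 ∨ D = 48 ∨ D = -48) (hdisc : NumberField.discr K = D)
    (J : Ideal (𝓞 K)) (hJ : Ideal.absNorm J = 2) :
    ∃ (t : K) (d : ℤ), t ^ 2 = (d : K) ∧ ¬ IsSquare d := by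
  classical
  have e : (K →+* ℂ) ≃ Fin 4 := Fintype.equivFinOfCardEq (by rw [NumberField.Embeddings.card, h4])
  have hJ0 : J ≠ ⊥ := by
    intro h; rw [h, Ideal.absNorm_bot] at hJ; exact absurd hJ (by norm_num)
  obtain ⟨a, haJ, ha0, hle⟩ := exists_ne_zero_mem_sum_embeddings_pow_le_of_ideal K J hJ0
  rw [h4, hJ, hdisc] at hle
  -- N(a) = ±2
  have hdvd : (2 : ℤ) ∣ Algebra.norm ℤ a := by
    have h1 : Ideal.absNorm J ∣ Ideal.absNorm (Ideal.span {a}) :=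
      Ideal.absNorm_dvd_absNorm_of_le ((Ideal.span_singleton_le_iff_mem _).mpr haJ)
    rw [hJ, Ideal.absNorm_span_singleton] at h1
    exact Int.ofNat_dvd_left.mpr h1
  have hN0 : Algebra.norm ℤ a ≠ 0 := by
    rw [Ne, Algebra.norm_eq_zero_iff]; exact ha0
  have hr2 := nrComplexPlaces_le_two (K := K) h4
  have hS : (∑ σ : K →+* ℂ, ‖σ (a : K)‖) ^ 4 ≤ 934 := by
    refine hle.trans ?_
    rcases hD with rfl | rfl | rfl | rfl
    · exact_mod_cast (minkowski_const_le_of_natAbs hr2 (D := 144)).1 rfl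
    · exact_mod_cast (minkowski_const_le_of_natAbs hr2 (D := -144)).1 rfl
    · have := (minkowski_const_le_of_natAbs hr2 (D := 48)).2 rfl; push_cast at this ⊢; linarith
    · have := (minkowski_const_le_of_natAbs hr2 (D := -48)).2 rfl; push_cast at this ⊢; linarith
  have hS48 : D.natAbs = 48 → (∑ σ : K →+* ℂ, ‖σ (a : K)‖) ^ 4 ≤ 540 := fun h48 =>
    hle.trans (by exact_mod_cast (minkowski_const_le_of_natAbs hr2 (D := D)).2 h48)
  -- |N(a)| ≤ S⁴/256 < 4
  have hP : (|(Algebra.norm ℤ a : ℤ)| : ℝ) ≤ 934 / 256 := by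
    rw [abs_norm_int_cast_eq_prod_norm e a]
    have := four_amgm (norm_nonneg ((e.symm 0) (a : K))) (norm_nonneg ((e.symm 1) (a : K)))
      (norm_nonneg ((e.symm 2) (a : K))) (norm_nonneg ((e.symm 3) (a : K)))
    rw [← sum_norm_embeddings_eq_sum e (a : K)] at this
    linarith
  have hN : Algebra.norm ℤ a = 2 ∨ Algebra.norm ℤ a = -2 := by
    have h3 : |Algebra.norm ℤ a| ≤ 3 := by
      have : (|(Algebra.norm ℤ a : ℤ)| : ℝ) < 4 := by linarith
      have : |Algebra.norm ℤ a| < 4 := by exact_mod_cast this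
      omega
    obtain ⟨q, hq⟩ := hdvd
    rw [hq] at h3 hN0 ⊢
    have : |q| ≤ 1 := by
      rw [abs_mul] at h3; norm_num at h3; omega
    rcases (abs_le.mp this) with ⟨hq1, hq2⟩
    interval_cases q <;> simp_all
  exact exists_sq_eq_nonsquare_of_small h4 e hD hdisc a hN hS hS48

/-- Corollary in subfield language: such a `K` has an intermediate field of degree `2` over `ℚ`… stated here as the
existence of an element with non-square integer square, which is what the consumer (`…_of_sq_eq_of_not_isSquare`)
takes. The four discriminants separately. [cite: EsmondeMurty1999, Ex. 6.5.12 and Ex. 6.5.21 p. 93] -/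
theorem exists_sq_eq_nonsquare_of_natAbs_discr (h4 : finrank ℚ K = 4)
    (hdisc : (NumberField.discr K).natAbs = 144 ∨ (NumberField.discr K).natAbs = 48)
    (J : Ideal (𝓞 K)) (hJ : Ideal.absNorm J = 2) :
    ∃ (t : K) (d : ℤ), t ^ 2 = (d : K) ∧ ¬ IsSquare d := by
  refine exists_sq_eq_nonsquare_of_absNorm_eq_two h4 (D := NumberField.discr K) ?_ rfl J hJ
  rcases hdisc with h | h <;> [have := Int.natAbs_eq_iff.mp h; have := Int.natAbs_eq_iff.mp h] <;> omega

end Soundness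

end Literature.NumberTheory.NumberFields
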